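import Literature.AlgebraicGeometry.ModuliOfAbelianVarieties.SymplecticLiftOfMarking
import Literature.AlgebraicGeometry.ModuliOfAbelianVarieties.SiegelAdelicMarkingPrincipalTransport
import Literature.AlgebraicGeometry.ModuliOfAbelianVarieties.SiegelPrincipalLevelSimilitudeTower
import Literature.AlgebraicGeometry.ModuliOfAbelianVarieties.SiegelModuliComplexUniformisation
import HarnessLib

/-!
# Admissibility of a principal representative: the (U3) existence clause assembled from a framed level-one marking
# ([Milne 2005] Thm. 6.11 «`(A, s, ηK) ↦ [J, a]`»; [Deligne 1971] 4.12 (b), 4.16; [Lan 2013] Lemma 1.3.6.5)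

Topic `AlgebraicGeometry/ModuliOfAbelianVarieties`; namespace `Literature.AlgebraicGeometry.ModuliOfAbelianVarieties`.
KERNEL ONLY: theorems; no definition, no named fact, no instance, no `sorry`.  Cell `hodgecm-mathlib`, rung-0 U-DAG
brick **B4 (d)** (B-p03 CENSUS-B4 §2 (d); router B-plan1 R53/R60; director s109): the EXISTENCE half of (U)'s junction
clause ★ `IsAdmissibleAt` (★ `SiegelModuliComplexUniformisation` :77–:88), assembled from the ★ bricks
(b) `SiegelAdelicMarking.exists_symplecticLift_of_levelReading` (a symplectic lift BUILT from a marking, given the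
pairing readings `hpair` and the level readings `hlevel`) and (c) `SiegelAdelicMarking.exists_principalRep_of_frame`
(transport of a level-one marking to a principal representative `r = diag(1, u·1)` with the same level-`N` readings).
HC_CM is proved only modulo the 7 printed citations until rung 0 closes.

SETTING ([Milne2005ShimuraVarieties] Thm. 6.11, proof p. 75: «choose … `a : V(𝔸_f) → V_f(A)` … then `a Λ̂ = η(V(ẑ))`
… the class `[J, a]` is well defined»).  A complex abelian variety `A` (below: the fibre of a polarised abelian scheme
with level-`N` structure `P′` over `Spec ℂ`) is MARKED by `[J(Z₀), a₀]`, `a₀ ∈ K_δ(1)` (★ T1′ `SiegelAdelicMarking`; its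
torsion parametrisation `u = m₀.r : ℚ^{2g} → A(ℂ)_tors`).  A point `P` is READ at a class `c` THROUGH `b ∈ GSp_δ(𝔸_f)`
when `P = u(v)` for every `v` with `b⁻¹ v̂ ≡ ĉ (mod ẑ^{2g})` (★ `AdelicCongr b⁻¹ 1 v c`).

* §0 two pieces of bookkeeping: `SiegelAdelicMarking.r_eq_r_mulVec_of_heq` (markings with the same chart and
  uniformisation and basis matrices `γ = q⁻¹ γ₀` have `u(v) = u₀(q v)` — the torsion parametrisation of (c)'s
  transported marking) and powers of roots of unity modulo the level;
* §1 **`SiegelAdelicMarking.exists_pairingRead_of_pairingRead`** — THE `hpair` FRAME CHANGE: if the Weil pairing of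
  `Θ` on points read at `x̃/M`, `ỹ/M` THROUGH `b₁ ∈ K_δ(1)` is `ζ_M ^ E_δ(x, y)` for a compatible system of primitive
  roots `ζ`, then through any other `b₂ ∈ K_δ(1)` it is `ζ′_M ^ E_δ(x, y)` with `ζ′_M = ζ_M ^ ν̄_M`, `ν̄` the multiplier
  tower of `k = b₁⁻¹ b₂` (★ `exists_similitudeTower`: the reductions `k̄_M` are similitudes of `E_δ mod M` with multiplier
  `ν̄_M`; ★ `adelicCongr_val_div_of_entries_residue`: `k·(x̃/M) ≡ (k̄_M x)~/M`) — Milne's «`(ℤ/Nℤ)^×`-multiple of `e_N`»,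
  [Deligne1971TravauxShimura] 4.16 «similitudes symplectiques»;
* §2 **`exists_isAdmissibleAt_of_frame`** — THE (U3) EXISTENCE CLAUSE FROM A FRAMED MARKING: given `P′` over `Spec ℂ`,
  an ample `Θ` with `λ̄ = Λ(𝒪(Θ))` at the point, a marking `m₀` of the fibre by `[J(Z₀), a₀]` (`a₀ ∈ K_δ(1)`) whose
  pairing readings through some `b ∈ K_δ(1)` are `ζ_M ^ E_δ` (the D5 identity «algebraic `ē^Θ` = exponential of
  `c₁(𝒪(Θ)^an)`» in Siegel normal form — an INPUT here), a symplectic lift `Λ₀` of the level structure (★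
  `IsSymplecticLiftable.nonempty`) and an integral frame `k₀ ∈ K_δ(1)` through which `Λ₀`'s level-`N` layer is read
  (the inverse-limit frame of ★ `IntegralAdelesInverseLimit` — an INPUT here), THERE ARE the (U3) data `(c, u, r)`
  (clauses of ★ `SiegelShimuraSet.exists_principalRep` verbatim) and `Z ∈ 𝔥_g` with `IsAdmissibleAt hδ r Z hZ P′`.
  Proof: (c) moves `m₀` to `m` by `[J(Z), r]` with `u_m(v) = u₀(M v)`, `M ∈ Sp_δ(ℤ)`, and the level-`N` readings of `Λ₀`
  through `k₀` become readings through `r` (`hlevel` by `Λ₀.lift_level`); §1 carries `hpair` from `b` to `k₁ = M_𝔸 r`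
  for `m₀`, which IS `hpair` through `r` for `m` (★ `adelicCongr_rationalMove_iff`); (b) builds `Λ` read through `r`.

## References
* [Milne2005ShimuraVarieties] J. S. Milne, *Introduction to Shimura varieties* (2005), §6 Thm. 6.11 and its proof
  (pp. 74–75), §5 Lemma 5.13 p. 57, §12 (63) p. 116.
* [Deligne1971TravauxShimura] P. Deligne, *Travaux de Shimura*, Sém. Bourbaki 389 (1971), 4.12 (b) pp. 148–149,
  Exemple 4.16 p. 150.
* [Lan2013PELCompactifications] K.-W. Lan, *Arithmetic compactifications of PEL-type Shimura varieties* (2013),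
  §1.3.6 Def. 1.3.6.2 (p. 80), Lemma 1.3.6.5 (p. 81).
-/

set_option autoImplicit false

noncomputable section

open Matrix NumberField IsDedekindDomain CategoryTheory AlgebraicGeometry

namespace Literature.AlgebraicGeometry.ModuliOfAbelianVarieties

open Literature.AlgebraicGeometry.Motives (AbelianVariety AlgPoints CartierDivisor specOver)
open Literature.AlgebraicGeometry.AbelianSchemes (AbelianSchemeOver PolarizedAbelianSchemeWithLevel)
open Literature.Geometry.Kaehler (ComplexTorus)
open Literature.NumberTheory.Adeles
open Literature.NumberTheory.Automorphic (siegelUpperHalfSpace)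
open SiegelModuli

variable {g : ℕ} {δ : Fin g → ℕ}

/-! ### §0. Bookkeeping -/

/-- Powers of an `M`-th root of unity depend only on the exponent mod `M`. [folklore] -/
private theorem pow_eq_pow_mod_of_pow_eq_one {z : ℂ} {M : ℕ} (h : z ^ M = 1) (a : ℕ) : z ^ a = z ^ (a % M) := by
  conv_lhs => rw [← Nat.mod_add_div a M]
  rw [pow_add, pow_mul, h, one_pow, mul_one]

namespace SiegelAdelicMarking

variable {J J₀ : C0pm δ} {a a₀ : gspFinAdelic δ} {A : AbelianVariety ℂ}

/-- **Torsion parametrisation of a transported marking**: two markings of the same `A` with the same complex chart `Ψ`,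
the same uniformisation, and basis matrices `γ = q⁻¹ γ₀` have `u(v) = u₀(q v)` (`u(v) = toFun [γ⁻¹ v]`,
`γ⁻¹ = γ₀⁻¹ q`) — the shape of ★ (c) `exists_principalRep_of_frame`'s clauses `m.Ψ = m₀.Ψ ∧ HEq m.toFun m₀.toFun ∧
m.γ = M_ℚ⁻¹ γ₀`. [cite: Milne2005ShimuraVarieties, §6 Thm. 6.11 p. 74 and p. 75] -/
theorem r_eq_r_mulVec_of_heq (m : SiegelAdelicMarking J a A) (m₀ : SiegelAdelicMarking J₀ a₀ A)
    (q : GL (Fin g ⊕ Fin g) ℚ) (hΨ : m.Ψ = m₀.Ψ) (hto : HEq m.toFun m₀.toFun) (hγ : m.γ = q⁻¹ * m₀.γ)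
    (v : Fin g ⊕ Fin g → ℚ) :
    m.r v = m₀.r (((q : GL (Fin g ⊕ Fin g) ℚ) : Matrix (Fin g ⊕ Fin g) (Fin g ⊕ Fin g) ℚ) *ᵥ v) := by
  obtain ⟨γ, hb, Ψ, hJ, f, hA, hadd⟩ := m
  dsimp only at hΨ hto hγ
  subst hΨ
  subst hγ
  have hf := eq_of_heq hto
  subst hf
  rw [r_def, r_def]
  dsimp only
  congr 3
  rw [_root_.mul_inv_rev, inv_inv, Units.val_mul, Matrix.mulVec_mulVec]

/-! ### §1. The `hpair` frame change between two integral frames -/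

/-- **FRAME CHANGE FOR THE PAIRING READINGS.**  Let `m` mark `A` (torsion parametrisation `u`), `Θ` a divisor on `A`,
`b₁, b₂ ∈ K_δ(1) = GSp_δ(ẑ)`, and `ζ = (ζ_M)_{N ∣ M}` a compatible system of primitive roots of unity such that for every
level `N ∣ M` the Weil pairing of `Θ` on `M`-torsion points READ at `x̃/M`, `ỹ/M` THROUGH `b₁` is `ζ_M ^ E_δ(x, y)`.  Then
there is a compatible system of primitive roots `ζ′` (namely `ζ′_M = ζ_M ^ ν̄_M`, `ν̄` the multiplier tower of
`k = b₁⁻¹ b₂ ∈ K_δ(1)`, ★ `exists_similitudeTower`) such that the pairing on points read THROUGH `b₂` is `ζ′_M ^ E_δ(x, y)`: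
a point read at `x̃/M` through `b₂` is read at `(k̄_M x)~/M` through `b₁` (★ `adelicCongr_val_div_of_entries_residue`:
`k·(x̃/M) ≡ (k̄_M x)~/M (mod ẑ^{2g})`), and `E_δ(k̄_M x, k̄_M y) = ν̄_M · E_δ(x, y)` (the reductions of `k` are similitudes).
This is the change of the symplectic similitude `ẑ^{2g} ⥲ T̂(A)` by an element of `GSp_δ(ẑ)` ([Deligne1971TravauxShimura]
4.16; [Milne2005ShimuraVarieties] p. 75 «`s` (resp. `ψ`) a `(ℤ/Nℤ)^×`-multiple of `e_N`»).
[cite: Deligne1971TravauxShimura, 4.12 (b) pp. 148–149 and Exemple 4.16 p. 150] [cite: Milne2005ShimuraVarieties, §6 Thm. 6.11 p. 74 and p. 75] -/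
theorem exists_pairingRead_of_pairingRead (hδ : IsPolarizationType δ) (hg : 0 < g) (m : SiegelAdelicMarking J a A)
    (Θ : CartierDivisor A.X.left) {N : ℕ} {b₁ b₂ : gspFinAdelic δ} (hb₁ : b₁ ∈ principalLevelSubgroup δ 1)
    (hb₂ : b₂ ∈ principalLevelSubgroup δ 1)
    (ζ : ℕ → ℂ) (hζ : ∀ ⦃M : ℕ⦄, N ∣ M → M ≠ 0 → IsPrimitiveRoot (ζ M) M)
    (hζ_pow : ∀ ⦃M : ℕ⦄ (k : ℕ), N ∣ M → M ≠ 0 → k ≠ 0 → ζ (k * M) ^ k = ζ M)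
    (hpair : ∀ ⦃M : ℕ⦄, N ∣ M → ∀ (hMΩ : (M : ℂ) ≠ 0) (x y : Fin g ⊕ Fin g → ZMod M)
      (P Q : A.torsionPoints ℂ (M : ℤ)),
      (∀ v, AdelicCongr ((b₁⁻¹ : gspFinAdelic δ) : GL (Fin g ⊕ Fin g) finAdeleQ) 1 v
          (fun i => ((x i).val : ℚ) / M) → (P : A.Points ℂ) = m.r v) →
      (∀ w, AdelicCongr ((b₁⁻¹ : gspFinAdelic δ) : GL (Fin g ⊕ Fin g) finAdeleQ) 1 w
          (fun i => ((y i).val : ℚ) / M) → (Q : A.Points ℂ) = m.r w) →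
      haveI := AbelianVariety.isDominant_toSchemeHom_zsmul_of_ne_zero A hMΩ
      A.weilPairingLevel Θ P Q = ζ M ^ (AbelianSchemeOver.typeFormMod δ M x y).val) :
    ∃ ζ' : ℕ → ℂ, (∀ ⦃M : ℕ⦄, N ∣ M → M ≠ 0 → IsPrimitiveRoot (ζ' M) M) ∧
      (∀ ⦃M : ℕ⦄ (k : ℕ), N ∣ M → M ≠ 0 → k ≠ 0 → ζ' (k * M) ^ k = ζ' M) ∧
      ∀ ⦃M : ℕ⦄, N ∣ M → ∀ (hMΩ : (M : ℂ) ≠ 0) (x y : Fin g ⊕ Fin g → ZMod M)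
        (P Q : A.torsionPoints ℂ (M : ℤ)),
        (∀ v, AdelicCongr ((b₂⁻¹ : gspFinAdelic δ) : GL (Fin g ⊕ Fin g) finAdeleQ) 1 v
            (fun i => ((x i).val : ℚ) / M) → (P : A.Points ℂ) = m.r v) →
        (∀ w, AdelicCongr ((b₂⁻¹ : gspFinAdelic δ) : GL (Fin g ⊕ Fin g) finAdeleQ) 1 w
            (fun i => ((y i).val : ℚ) / M) → (Q : A.Points ℂ) = m.r w) →
        haveI := AbelianVariety.isDominant_toSchemeHom_zsmul_of_ne_zero A hMΩ
        A.weilPairingLevel Θ P Q = ζ' M ^ (AbelianSchemeOver.typeFormMod δ M x y).val := by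
  classical
  -- the transition element `k = b₁⁻¹ b₂ ∈ K_δ(1)` and its similitude tower
  set k : gspFinAdelic δ := b₁⁻¹ * b₂ with hk_def
  have hk : k ∈ principalLevelSubgroup δ 1 := mul_mem (inv_mem hb₁) hb₂
  obtain ⟨Γ, ν, hΓres, -, hνcompat, hsim⟩ := exists_similitudeTower δ hδ hg hk
  -- integrality of `k⁻¹`
  have hint : ∀ i j, ((((k⁻¹ : gspFinAdelic δ) : GL (Fin g ⊕ Fin g) finAdeleQ) :
      Matrix (Fin g ⊕ Fin g) (Fin g ⊕ Fin g) finAdeleQ) i j) ∈ FiniteAdeleRing.integralAdeles (𝓞 ℚ) ℚ := fun i j =>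
    isIntegral_of_isCongOne_one (A := (((k⁻¹ : gspFinAdelic δ) : GL (Fin g ⊕ Fin g) finAdeleQ) :
      Matrix (Fin g ⊕ Fin g) (Fin g ⊕ Fin g) finAdeleQ)) ((mem_principalLevelSubgroup_iff δ).1 (inv_mem hk)).1 i j
  -- the group identities `k⁻¹ b₁⁻¹ = b₂⁻¹`, `k⁻¹ k = 1` in `GL`
  have hGL₁ : ((k⁻¹ : gspFinAdelic δ) : GL (Fin g ⊕ Fin g) finAdeleQ) * ((b₁⁻¹ : gspFinAdelic δ) : GL (Fin g ⊕ Fin g) finAdeleQ) =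
      ((b₂⁻¹ : gspFinAdelic δ) : GL (Fin g ⊕ Fin g) finAdeleQ) := by
    rw [← Subgroup.coe_mul, hk_def, _root_.mul_inv_rev, inv_inv, mul_inv_cancel_right]
  have hGL₂ : ((k⁻¹ : gspFinAdelic δ) : GL (Fin g ⊕ Fin g) finAdeleQ) * ((k : gspFinAdelic δ) : GL (Fin g ⊕ Fin g) finAdeleQ) = 1 := by
    rw [← Subgroup.coe_mul, inv_mul_cancel, Subgroup.coe_one]
  -- a point read at `x̃/M` through `b₂` is read at `(Γ_M x)~/M` through `b₁`
  have hread : ∀ {M : ℕ} (hM : M ≠ 0) (x : Fin g ⊕ Fin g → ZMod M) (P : A.Points ℂ),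
      (∀ v, AdelicCongr ((b₂⁻¹ : gspFinAdelic δ) : GL (Fin g ⊕ Fin g) finAdeleQ) 1 v
          (fun i => ((x i).val : ℚ) / M) → P = m.r v) →
      ∀ v, AdelicCongr ((b₁⁻¹ : gspFinAdelic δ) : GL (Fin g ⊕ Fin g) finAdeleQ) 1 v
          (fun i => ((((Γ M : Matrix (Fin g ⊕ Fin g) (Fin g ⊕ Fin g) (ZMod M)) *ᵥ x) i).val : ℚ) / M) → P = m.r v := by
    intro M hM x P hP v hv
    haveI : NeZero M := ⟨hM⟩
    have hres := adelicCongr_val_div_of_entries_residue hk (Γ M : Matrix (Fin g ⊕ Fin g) (Fin g ⊕ Fin g) (ZMod M))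
      (hΓres M) x
    have h1 := hv.trans (adelicCongr_comm.1 hres)
    have h2 := h1.mul_left (u := ((k⁻¹ : gspFinAdelic δ) : GL (Fin g ⊕ Fin g) finAdeleQ)) hint
    rw [hGL₁, hGL₂] at h2
    exact hP v h2
  refine ⟨fun M => ζ M ^ ((ν M : ZMod M)).val, fun M hNM hM => ?_, fun M k' hNM hM hk' => ?_,
    fun M hNM hMΩ x y P Q hP hQ => ?_⟩
  · -- primitivity: `ν̄_M` is a unit mod `M`
    exact (hζ hNM hM).pow_of_coprime _ (ZMod.val_coe_unit_coprime (ν M))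
  · -- compatibility: `(ζ_{kM} ^ ν̄_{kM})^k = ζ_M ^ ν̄_{kM} = ζ_M ^ ν̄_M`
    have hM' : k' * M ≠ 0 := mul_ne_zero hk' hM
    haveI : NeZero M := ⟨hM⟩
    haveI : NeZero (k' * M) := ⟨hM'⟩
    have hval : ((ν M : ZMod M)).val = ((ν (k' * M) : ZMod (k' * M))).val % M := by
      rw [← hνcompat k' hM hk', ZMod.castHom_apply, ZMod.cast_eq_val, ZMod.val_natCast]
    dsimp only
    rw [← pow_mul, mul_comm ((ν (k' * M) : ZMod (k' * M))).val k', pow_mul, hζ_pow k' hNM hM hk', hval]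
    exact pow_eq_pow_mod_of_pow_eq_one (hζ hNM hM).pow_eq_one _
  · -- the pairing: read through `b₁` at `Γ_M x`, `Γ_M y`, then use the similitude property of `Γ_M`
    have hM : M ≠ 0 := by rintro rfl; exact hMΩ Nat.cast_zero
    haveI : NeZero M := ⟨hM⟩
    have h := hpair hNM hMΩ ((Γ M : Matrix (Fin g ⊕ Fin g) (Fin g ⊕ Fin g) (ZMod M)) *ᵥ x)
      ((Γ M : Matrix (Fin g ⊕ Fin g) (Fin g ⊕ Fin g) (ZMod M)) *ᵥ y) P Q (hread hM x P hP) (hread hM y Q hQ)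
    dsimp only
    rw [h, hsim hM x y, ZMod.val_mul, ← pow_eq_pow_mod_of_pow_eq_one ((hζ hNM hM).pow_eq_one), pow_mul]

end SiegelAdelicMarking

/-! ### §2. The (U3) existence clause from a framed level-one marking -/

/-- **ADMISSIBILITY OF A PRINCIPAL REPRESENTATIVE FROM A FRAMED LEVEL-ONE MARKING** (the existence half of (U3) in ★
`siegelModuli_complexUniformisation`, assembled; [Milne2005ShimuraVarieties] Thm. 6.11 «to `(A, s, ηK)` attach `[J, a]`»,
with Lemma 5.13 `a = q·g·k` choosing the principal representative; [Deligne1971TravauxShimura] 4.12 (b) «`k_n` … peuvent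
se relever en des isomorphismes symplectiques `k : T̂(B) → V_ẑ`»; [Lan2013PELCompactifications] Lemma 1.3.6.5).
DATA: `δ` a polarisation type, `0 < g`, `N ≠ 0`; `P′` a polarised abelian scheme of type `δ` with level-`N` structure
over `Spec ℂ`; an ample divisor `Θ` on the fibre with `λ̄ = Λ(𝒪(Θ))` there; a marking `m₀` of the fibre by `[J(Z₀), a₀]`,
`a₀ ∈ K_δ(1)`; a compatible system of primitive roots `ζ` for which the Weil pairing of `Θ` on points read through
some `b ∈ K_δ(1)` is `ζ_M ^ E_δ` at every level `N ∣ M` (`hpair`: the D5 identity in Siegel normal form, an INPUT); a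
symplectic lift `Λ₀` of the level structure for `Θ` (★ `IsSymplecticLiftable.nonempty` on `P′.symplectic`) and an
integral frame `k₀ ∈ K_δ(1)` through which its level-`N` layer is read via `m₀` (`hframe`, an INPUT: the inverse limit of
the finite frames, ★ `IntegralAdelesInverseLimit`).  CONCLUSION: the (U3) data — `c ∈ (ℤ/N)^×`, a `ẑ`-unit `u ≡ c (mod N)`,
the principal representative `r = diag(1_g, u·1_g) ∈ K_δ(1)` of multiplier `u` — and `Z ∈ 𝔥_g` with
`IsAdmissibleAt hδ r Z hZ P′`: a marking `m` by `[J(Z), r]`, the witness `Θ`, and a symplectic lift `Λ` whose WHOLE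
tower is read through `r` (`r⁻¹ v̂ ≡ x̃/M ⟹ Λ_M(x) = u_m(v)`).  Proof: ★ (c) `exists_principalRep_of_frame` (move to
`[J(Z), r]`, `u_m(v) = u₀(M v)`, level-`N` readings transported, so `hlevel` by `Λ₀.lift_level`); §1 from `b` to
`k₁ = M_𝔸 · r ∈ K_δ(1)` for `m₀`, which is `hpair` through `r` for `m` (★ `adelicCongr_rationalMove_iff`); ★ (b)
`exists_symplecticLift_of_levelReading`. [cite: Milne2005ShimuraVarieties, §6 Thm. 6.11 pp. 74–75 and §5 Lemma 5.13 p. 57]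
[cite: Deligne1971TravauxShimura, 4.12 (b) pp. 148–149 and 4.16 p. 150] [cite: Lan2013PELCompactifications, §1.3.6 Lemma 1.3.6.5 (p. 81)] -/
theorem exists_isAdmissibleAt_of_frame (hδ : IsPolarizationType δ) (hg : 0 < g) {N : ℕ} (hN : N ≠ 0)
    (P' : PolarizedAbelianSchemeWithLevel g N δ (specOver ℚ ℂ).left)
    (Θ : CartierDivisor (P'.A.fibre (𝟙 (Spec (CommRingCat.of ℂ)))).toAbelianVariety.X.left) (hΘ : Θ.IsAmple)
    (hlam : P'.A.IsLambdaOfAt (𝟙 (Spec (CommRingCat.of ℂ))) P'.D P'.pol.lam Θ)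
    (Z₀ : siegelUpperHalfSpace g) {a₀ : gspFinAdelic δ} (ha₀ : a₀ ∈ principalLevelSubgroup δ 1)
    (m₀ : SiegelAdelicMarking ⟨jOfSiegel δ Z₀, jOfSiegel_coe_mem_C0pm hδ.1 Z₀⟩ a₀
      (P'.A.fibre (𝟙 (Spec (CommRingCat.of ℂ)))).toAbelianVariety)
    {b : gspFinAdelic δ} (hb : b ∈ principalLevelSubgroup δ 1)
    (ζ : ℕ → ℂ) (hζ : ∀ ⦃M : ℕ⦄, N ∣ M → M ≠ 0 → IsPrimitiveRoot (ζ M) M)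
    (hζ_pow : ∀ ⦃M : ℕ⦄ (k : ℕ), N ∣ M → M ≠ 0 → k ≠ 0 → ζ (k * M) ^ k = ζ M)
    (hpair : ∀ ⦃M : ℕ⦄, N ∣ M → ∀ (hMΩ : (M : ℂ) ≠ 0) (x y : Fin g ⊕ Fin g → ZMod M)
      (P Q : (P'.A.fibre (𝟙 (Spec (CommRingCat.of ℂ)))).toAbelianVariety.torsionPoints ℂ (M : ℤ)),
      (∀ v, AdelicCongr ((b⁻¹ : gspFinAdelic δ) : GL (Fin g ⊕ Fin g) finAdeleQ) 1 v
          (fun i => ((x i).val : ℚ) / M) →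
          (P : (P'.A.fibre (𝟙 (Spec (CommRingCat.of ℂ)))).toAbelianVariety.Points ℂ) = m₀.r v) →
      (∀ w, AdelicCongr ((b⁻¹ : gspFinAdelic δ) : GL (Fin g ⊕ Fin g) finAdeleQ) 1 w
          (fun i => ((y i).val : ℚ) / M) →
          (Q : (P'.A.fibre (𝟙 (Spec (CommRingCat.of ℂ)))).toAbelianVariety.Points ℂ) = m₀.r w) →
      haveI := AbelianVariety.isDominant_toSchemeHom_zsmul_of_ne_zero
        (P'.A.fibre (𝟙 (Spec (CommRingCat.of ℂ)))).toAbelianVariety hMΩ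
      (P'.A.fibre (𝟙 (Spec (CommRingCat.of ℂ)))).toAbelianVariety.weilPairingLevel Θ P Q =
        ζ M ^ (AbelianSchemeOver.typeFormMod δ M x y).val)
    (Λ₀ : P'.level.SymplecticLift (𝟙 (Spec (CommRingCat.of ℂ))) Θ δ)
    {k₀ : gspFinAdelic δ} (hk₀ : k₀ ∈ principalLevelSubgroup δ 1)
    (hframe : ∀ (x : Fin g ⊕ Fin g → ZMod N) (w : Fin g ⊕ Fin g → ℚ),
      AdelicCongr ((k₀⁻¹ : gspFinAdelic δ) : GL (Fin g ⊕ Fin g) finAdeleQ) 1 w (fun i => ((x i).val : ℚ) / N) →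
        ((Λ₀.lift N (Multiplicative.ofAdd x)) :
          (P'.A.fibre (𝟙 (Spec (CommRingCat.of ℂ)))).toAbelianVariety.Points ℂ) = m₀.r w) :
    ∃ (c : (ZMod N)ˣ) (u : finAdeleQˣ) (r : gspFinAdelic δ),
      (∀ v, Valued.v ((u : finAdeleQ) v) = 1) ∧
      (u : finAdeleQ) - ((c : ZMod N).val : ℕ) ∈ levelIdeal N ∧
      r ∈ principalLevelSubgroup δ 1 ∧
      IsMultiplier (typeFormOver δ finAdeleQ) (r : GL (Fin g ⊕ Fin g) finAdeleQ) u ∧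
      ((r : GL (Fin g ⊕ Fin g) finAdeleQ) : Matrix (Fin g ⊕ Fin g) (Fin g ⊕ Fin g) finAdeleQ) =
        Matrix.fromBlocks 1 0 0 ((u : finAdeleQ) • (1 : Matrix (Fin g) (Fin g) finAdeleQ)) ∧
      ∃ (Z : Matrix (Fin g) (Fin g) ℂ) (hZ : Z ∈ siegelUpperHalfSpace g), IsAdmissibleAt hδ r Z hZ P' := by
  classical
  -- (c): transport to a principal representative with the same level-`N` readings
  obtain ⟨c, u, r, M, hM, m, hu, hc, hr, hru, hrmat, -, hΨ, hto, hγ, hread⟩ :=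
    SiegelAdelicMarking.exists_principalRep_of_frame hδ hg hN Z₀ ha₀ m₀ k₀ hk₀
  set q : gspRational δ := ⟨Matrix.GeneralLinearGroup.map (Int.castRingHom ℚ) M,
    map_mem_gspRational_of_mem_symplecticLatticeGroup δ hM⟩ with hq
  -- the torsion parametrisation of `m`: `u_m(v) = u₀(M v)`
  have hrv : ∀ v, m.r v = m₀.r ((((q : gspRational δ) : GL (Fin g ⊕ Fin g) ℚ) :
      Matrix (Fin g ⊕ Fin g) (Fin g ⊕ Fin g) ℚ) *ᵥ v) := fun v =>
    m.r_eq_r_mulVec_of_heq m₀ _ hΨ hto hγ v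
  -- `k₁ := M_𝔸 · r ∈ K_δ(1)`
  have hq1 : gspRationalToFinAdelic δ q ∈ principalLevelSubgroup δ 1 :=
    (map_mem_principalLevelSubgroup_iff_mem_siegelLevelGroup one_ne_zero hM).2
      (by rw [siegelLevelGroup_one]; exact hM)
  have hk₁ : gspRationalToFinAdelic δ q * r ∈ principalLevelSubgroup δ 1 := mul_mem hq1 hr
  -- §1: the pairing readings through `k₁` for `m₀`
  obtain ⟨ζ', hζ', hζ'_pow, hpair'⟩ :=
    m₀.exists_pairingRead_of_pairingRead hδ hg Θ hb hk₁ ζ hζ hζ_pow hpair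
  -- which are the pairing readings through `r` for `m`
  have hpair_m : ∀ ⦃M' : ℕ⦄, N ∣ M' → ∀ (hMΩ : (M' : ℂ) ≠ 0) (x y : Fin g ⊕ Fin g → ZMod M')
      (P Q : (P'.A.fibre (𝟙 (Spec (CommRingCat.of ℂ)))).toAbelianVariety.torsionPoints ℂ (M' : ℤ)),
      (∀ v, AdelicCongr ((r⁻¹ : gspFinAdelic δ) : GL (Fin g ⊕ Fin g) finAdeleQ) 1 v
          (fun i => ((x i).val : ℚ) / M') →
          (P : (P'.A.fibre (𝟙 (Spec (CommRingCat.of ℂ)))).toAbelianVariety.Points ℂ) = m.r v) →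
      (∀ w, AdelicCongr ((r⁻¹ : gspFinAdelic δ) : GL (Fin g ⊕ Fin g) finAdeleQ) 1 w
          (fun i => ((y i).val : ℚ) / M') →
          (Q : (P'.A.fibre (𝟙 (Spec (CommRingCat.of ℂ)))).toAbelianVariety.Points ℂ) = m.r w) →
      haveI := AbelianVariety.isDominant_toSchemeHom_zsmul_of_ne_zero
        (P'.A.fibre (𝟙 (Spec (CommRingCat.of ℂ)))).toAbelianVariety hMΩ
      (P'.A.fibre (𝟙 (Spec (CommRingCat.of ℂ)))).toAbelianVariety.weilPairingLevel Θ P Q =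
        ζ' M' ^ (AbelianSchemeOver.typeFormMod δ M' x y).val := by
    intro M' hNM' hMΩ x y P Q hP hQ
    refine hpair' hNM' hMΩ x y P Q (fun w hw => ?_) (fun w hw => ?_)
    · rw [SiegelAdelicMarking.adelicCongr_rationalMove_iff] at hw
      rw [hP _ hw, hrv, Matrix.mulVec_mulVec, ← Units.val_mul, mul_inv_cancel, Units.val_one, Matrix.one_mulVec]
    · rw [SiegelAdelicMarking.adelicCongr_rationalMove_iff] at hw
      rw [hQ _ hw, hrv, Matrix.mulVec_mulVec, ← Units.val_mul, mul_inv_cancel, Units.val_one, Matrix.one_mulVec]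
  -- the level readings through `r` for `m`
  have hlevel_m : ∀ i : Fin g ⊕ Fin g, ∃ v : Fin g ⊕ Fin g → ℚ,
      AdelicCongr ((r⁻¹ : gspFinAdelic δ) : GL (Fin g ⊕ Fin g) finAdeleQ) 1 v
          (fun j => (((Pi.single i (1 : ZMod N) : Fin g ⊕ Fin g → ZMod N) j).val : ℚ) / N) ∧
        P'.A.restrictPt (𝟙 (Spec (CommRingCat.of ℂ))) (P'.level.σ i) = m.r v := by
    intro i
    obtain ⟨v, hv⟩ := SiegelAdelicMarking.exists_adelicCongr_inv_one (a := r)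
      (fun j => (((Pi.single i (1 : ZMod N) : Fin g ⊕ Fin g → ZMod N) j).val : ℚ) / N)
    refine ⟨v, hv, ?_⟩
    obtain ⟨h1, h2⟩ := hread _ v hv
    rw [h1, ← hframe _ _ h2, ← Λ₀.lift_level i]
  -- (b): the symplectic lift built from `m`, read through `r`
  obtain ⟨Λ, -, htower⟩ :=
    m.exists_symplecticLift_of_levelReading P'.level Θ ζ' hζ' hζ'_pow hpair_m hlevel_m
  exact ⟨c, u, r, hu, hc, hr, hru, hrmat, _, (gDHom δ hδ.1 ⟨M⁻¹, inv_mem hM⟩ • Z₀).2,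
    m, Θ, Λ, hΘ, hlam, htower⟩

end Literature.AlgebraicGeometry.ModuliOfAbelianVarieties

end
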